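import Literature.Analysis.FluidPDE.RadialCalculus
import Literature.Analysis.FluidPDE.HessianLaplacian
import HarnessLib

/-!
# Zero-scar neutral mode of the linearised Leray operator — part 1/3: profiles, fields, radial calculus

Negative-side support for the crux `ScarRigidity` (stmt-NavierStokesRegularity-11717, route RellichScar),
written by its standing disprover (cdisprove seat, cycle 3).  This part carries no claim about the crux; it
builds the explicit objects used by parts 2–3 (`NeutralModeIdentity`, `NeutralMode` — see the latter for the
refuted statements and the meaning for provers):

* the radial profile layer `ζ(σ) = (1+σ)^{-1/2}` (`brInv`; `ζ²(1+σ) = 1`, `ζ' = −½ζ³`, derivative of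
  `p(σ)ζ^k`);
* the explicit profiles of the mode built on the Plummer potential `G = ζ(|y|²)`: `A = (2−σ)ζ⁵`, `B = 3ζ⁵`
  (velocity), `ϖ` (pressure), `θ = (15/4)(4σ²+57σ−73)ζ⁸` (potential), with their first/second derivatives;
* the fields `W(y) = A(|y|²)m + B(|y|²)(m·y)y`, `Π(y) = ϖ(|y|²)(m·y)`, `M(y) = θ(|y|²) y⊗y` and their
  smoothness;
* radial calculus on `ℝ³` over the tree's `RadialCalculus`: first derivative and Laplacian (`4σg'' + 6g'`)
  of `g(|y|²)`, derivative / gradient / Laplacian (`(4σg''+10g')(m·y)`) of `g(|y|²)(m·y)`, and `Δ` of a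
  continuous linear map (`= 0`).

## References

* D. Gilbarg, N. Trudinger, *Elliptic PDE of Second Order* (2001), (2.11) (radial Laplacian). [GilbargTrudinger2001]
-/

noncomputable section

open Set Filter Function MeasureTheory Metric TopologicalSpace InnerProductSpace
open scoped Topology ENNReal NNReal RealInnerProductSpace Laplacian

set_option linter.dupNamespace false

namespace Summit.NavierStokesRegularity.NavierStokesRegularity.Theorems.ScarRigidity.Negative

open Literature.Analysis.FluidPDE

/-- Physical / similarity space. -/
local notation "ℝ³" => EuclideanSpace ℝ (Fin 3)

/-! ### §7.1 The radial profile layer: `ζ(σ) = (1+σ)^{-1/2}` and polynomial multiples of its powers -/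

/-- `ζ(σ) = 1/√(1+σ)` — with `σ = ‖y‖²` this is the inverse Japanese bracket `⟨y⟩⁻¹`; `ζ²(1+σ) = 1`. -/
def brInv (σ : ℝ) : ℝ := (Real.sqrt (1 + σ))⁻¹

/-- `1 + σ > 0` for `σ > -1`. [folklore] -/
theorem one_add_pos {σ : ℝ} (hσ : -1 < σ) : 0 < 1 + σ := by linarith

/-- `ζ(σ) > 0` for `σ > -1`. [folklore] -/
theorem brInv_pos {σ : ℝ} (hσ : -1 < σ) : 0 < brInv σ :=
  inv_pos.2 (Real.sqrt_pos.2 (one_add_pos hσ))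

/-- The defining algebraic relation `ζ(σ)² (1+σ) = 1`. -/
theorem brInv_sq_mul {σ : ℝ} (hσ : -1 < σ) : brInv σ ^ 2 * (1 + σ) = 1 := by
  unfold brInv
  rw [inv_pow, Real.sq_sqrt (one_add_pos hσ).le, inv_mul_cancel₀ (one_add_pos hσ).ne']

/-- `ζ(0) = 1`. [folklore] -/
theorem brInv_zero : brInv 0 = 1 := by simp [brInv]

/-- Power bookkeeping: `ζ^k = ζ^(k+2) (1+σ)`. -/
theorem brInv_pow_eq {σ : ℝ} (hσ : -1 < σ) (k : ℕ) :
    brInv σ ^ k = brInv σ ^ (k + 2) * (1 + σ) := by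
  rw [pow_add, mul_assoc, brInv_sq_mul hσ, mul_one]

/-- `ζ' = -½ ζ³` on `σ > -1`. -/
theorem hasDerivAt_brInv {σ : ℝ} (hσ : -1 < σ) :
    HasDerivAt brInv (-(1 / 2) * brInv σ ^ 3) σ := by
  have hne1 : (1 : ℝ) + σ ≠ 0 := (one_add_pos hσ).ne'
  have h1 : HasDerivAt (fun σ : ℝ => 1 + σ) 1 σ := (hasDerivAt_id σ).const_add 1
  have h2 : HasDerivAt (fun σ : ℝ => Real.sqrt (1 + σ)) (1 / (2 * Real.sqrt (1 + σ))) σ := h1.sqrt hne1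
  have hsq : Real.sqrt (1 + σ) ≠ 0 := (Real.sqrt_pos.2 (one_add_pos hσ)).ne'
  have h3 := h2.inv hsq
  refine h3.congr_deriv ?_
  unfold brInv
  have hs2 : Real.sqrt (1 + σ) ^ 2 = 1 + σ := Real.sq_sqrt (one_add_pos hσ).le
  have hs3 : Real.sqrt (1 + σ) ^ 3 = (1 + σ) * Real.sqrt (1 + σ) := by rw [pow_succ, hs2]
  rw [hs2, inv_pow, hs3]
  field_simp

/-- Derivative of `p(σ) ζ(σ)^k`: `p' ζ^k - (k/2) p ζ^(k+2)`. -/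
theorem hasDerivAt_mul_brInv_pow {p : ℝ → ℝ} {p' σ : ℝ} (hσ : -1 < σ) (hp : HasDerivAt p p' σ)
    (k : ℕ) (hk : 1 ≤ k) :
    HasDerivAt (fun σ => p σ * brInv σ ^ k)
      (p' * brInv σ ^ k - (k / 2) * p σ * brInv σ ^ (k + 2)) σ := by
  have hz := hasDerivAt_brInv hσ
  have hpow : HasDerivAt (fun σ => brInv σ ^ k) ((k : ℝ) * brInv σ ^ (k - 1) * (-(1 / 2) * brInv σ ^ 3)) σ :=
    hz.pow k
  refine (hp.mul hpow).congr_deriv ?_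
  obtain ⟨j, rfl⟩ := Nat.exists_eq_add_of_le hk
  simp only [Nat.add_sub_cancel_left]
  ring

/-! ### §7.2 The profile functions (explicit; Plummer potential `G = ζ(|y|²)`) -/

/-- `A(σ) = (2-σ) ζ⁵`: the `m`-coefficient of `W`. -/
def modeA (σ : ℝ) : ℝ := (2 - σ) * brInv σ ^ 5
/-- `A'`. -/
def modeA₁ (σ : ℝ) : ℝ := (3 / 2 * σ - 6) * brInv σ ^ 7
/-- `A''`. -/
def modeA₂ (σ : ℝ) : ℝ := (45 / 2 - 15 / 4 * σ) * brInv σ ^ 9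
/-- `B(σ) = 3 ζ⁵`: the `(m·y) y`-coefficient of `W`. -/
def modeB (σ : ℝ) : ℝ := 3 * brInv σ ^ 5
/-- `B'`. -/
def modeB₁ (σ : ℝ) : ℝ := -(15 / 2) * brInv σ ^ 7
/-- `B''`. -/
def modeB₂ (σ : ℝ) : ℝ := 105 / 4 * brInv σ ^ 9
/-- `ϖ(σ)`: the pressure is `Π = ϖ(|y|²) (m·y)`. -/
def modeP (σ : ℝ) : ℝ := (-σ ^ 3 + 9 / 2 * σ ^ 2 + 159 / 2 * σ - 31) * brInv σ ^ 9
/-- `ϖ'`. -/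
def modeP₁ (σ : ℝ) : ℝ := (3 / 2 * σ ^ 3 - 57 / 4 * σ ^ 2 - 1077 / 4 * σ + 219) * brInv σ ^ 11
/-- `θ(σ) = (15/4)(4σ²+57σ-73) ζ⁸`: the potential is `M = θ(|y|²) y ⊗ y` (RATIONAL in `y`). -/
def modeT (σ : ℝ) : ℝ := 15 / 4 * (4 * σ ^ 2 + 57 * σ - 73) * brInv σ ^ 8

/-- `A' = A₁` on `σ > -1`. [folklore] -/
theorem hasDerivAt_modeA {σ : ℝ} (hσ : -1 < σ) : HasDerivAt modeA (modeA₁ σ) σ := by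
  have hp : HasDerivAt (fun σ : ℝ => 2 - σ) (-1) σ := by
    simpa using (hasDerivAt_id σ).const_sub 2
  refine (hasDerivAt_mul_brInv_pow hσ hp 5 (by norm_num)).congr_deriv ?_
  rw [modeA₁, brInv_pow_eq hσ 5]
  push_cast
  ring

/-- `A₁' = A₂` on `σ > -1`. [folklore] -/
theorem hasDerivAt_modeA₁ {σ : ℝ} (hσ : -1 < σ) : HasDerivAt modeA₁ (modeA₂ σ) σ := by
  have hp : HasDerivAt (fun σ : ℝ => 3 / 2 * σ - 6) (3 / 2) σ := by
    simpa using ((hasDerivAt_id σ).const_mul (3 / 2 : ℝ)).sub_const 6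
  refine (hasDerivAt_mul_brInv_pow hσ hp 7 (by norm_num)).congr_deriv ?_
  rw [modeA₂, brInv_pow_eq hσ 7]
  push_cast
  ring

/-- `B' = B₁` on `σ > -1`. [folklore] -/
theorem hasDerivAt_modeB {σ : ℝ} (hσ : -1 < σ) : HasDerivAt modeB (modeB₁ σ) σ := by
  have hp : HasDerivAt (fun _ : ℝ => (3 : ℝ)) 0 σ := hasDerivAt_const σ 3
  refine (hasDerivAt_mul_brInv_pow hσ hp 5 (by norm_num)).congr_deriv ?_
  rw [modeB₁]
  push_cast
  ring

/-- `B₁' = B₂` on `σ > -1`. [folklore] -/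
theorem hasDerivAt_modeB₁ {σ : ℝ} (hσ : -1 < σ) : HasDerivAt modeB₁ (modeB₂ σ) σ := by
  have hp : HasDerivAt (fun _ : ℝ => (-(15 / 2) : ℝ)) 0 σ := hasDerivAt_const σ _
  refine (hasDerivAt_mul_brInv_pow hσ hp 7 (by norm_num)).congr_deriv ?_
  rw [modeB₂]
  push_cast
  ring

/-- `ϖ' = ϖ₁` on `σ > -1`. [folklore] -/
theorem hasDerivAt_modeP {σ : ℝ} (hσ : -1 < σ) : HasDerivAt modeP (modeP₁ σ) σ := by
  have hp : HasDerivAt (fun σ : ℝ => -σ ^ 3 + 9 / 2 * σ ^ 2 + 159 / 2 * σ - 31)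
      (-(3 * σ ^ 2) + 9 / 2 * (2 * σ) + 159 / 2) σ := by
    have h3 : HasDerivAt (fun σ : ℝ => σ ^ 3) (3 * σ ^ 2) σ := by simpa using hasDerivAt_pow 3 σ
    have h2 : HasDerivAt (fun σ : ℝ => σ ^ 2) (2 * σ) σ := by simpa using hasDerivAt_pow 2 σ
    simpa using ((h3.neg.add (h2.const_mul (9 / 2 : ℝ))).add
      ((hasDerivAt_id σ).const_mul (159 / 2 : ℝ))).sub_const 31
  refine (hasDerivAt_mul_brInv_pow hσ hp 9 (by norm_num)).congr_deriv ?_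
  rw [modeP₁, brInv_pow_eq hσ 9]
  push_cast
  ring


/-! ### §7.3 The fields: velocity `W`, pressure `Π`, potential `M` (similarity variables) -/

/-- THE NEUTRAL MODE `W(y) = A(|y|²) m + B(|y|²) (m·y) y = ⟨y⟩⁻⁵[(2-|y|²)m + 3(m·y)y]`
(`= ∇(∂ₘG) − (ΔG)m = curl(⟨y⟩⁻³ m × y)` for the Plummer potential `G = ⟨y⟩⁻¹`). -/
def neutralW (m : ℝ³) (y : ℝ³) : ℝ³ := modeA (‖y‖ ^ 2) • m + (modeB (‖y‖ ^ 2) * ⟪m, y⟫) • y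

/-- ITS PRESSURE `Π(y) = ϖ(|y|²) (m·y)`. -/
def neutralP (m : ℝ³) (y : ℝ³) : ℝ := modeP (‖y‖ ^ 2) * ⟪m, y⟫

/-- THE CRITICAL MATRIX POTENTIAL `M(y) = θ(|y|²) y ⊗ y` (`M(y)v = θ ⟨y,v⟩ y`; `|M| ~ 15/|y|²`). -/
def neutralM (y : ℝ³) : ℝ³ →L[ℝ] ℝ³ := modeT (‖y‖ ^ 2) • (innerSL ℝ y).smulRight y

/-- `M(y)v = θ(|y|²)⟨y,v⟩ y`. [folklore] -/
theorem neutralM_apply (y v : ℝ³) : neutralM y v = (modeT (‖y‖ ^ 2) * ⟪y, v⟫) • y := by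
  simp [neutralM, mul_smul]

/-! ### §7.4 Smoothness -/

/-- `|y|² > -1`: the profile layer applies at every `σ = |y|²`. [folklore] -/
theorem neg_one_lt_norm_sq (y : ℝ³) : (-1 : ℝ) < ‖y‖ ^ 2 := by
  have := sq_nonneg ‖y‖; linarith

/-- `y ↦ ζ(|y|²) = (1+|y|²)^{-1/2}` is smooth on `ℝ³`. [folklore] -/
theorem contDiff_brInv_comp {n : ℕ∞} : ContDiff ℝ n (fun y : ℝ³ => brInv (‖y‖ ^ 2)) := by
  unfold brInv
  have h1 : ContDiff ℝ n (fun y : ℝ³ => (1 : ℝ) + ‖y‖ ^ 2) := contDiff_const.add (contDiff_norm_sq ℝ)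
  have hne : ∀ y : ℝ³, (1 : ℝ) + ‖y‖ ^ 2 ≠ 0 := fun y => by positivity
  have h2 : ContDiff ℝ n (fun y : ℝ³ => Real.sqrt (1 + ‖y‖ ^ 2)) := h1.sqrt hne
  exact h2.inv fun y => (Real.sqrt_pos.2 (by positivity)).ne'

/-- `y ↦ A(|y|²)` is smooth. [folklore] -/
theorem contDiff_modeA_comp {n : ℕ∞} : ContDiff ℝ n (fun y : ℝ³ => modeA (‖y‖ ^ 2)) := by
  unfold modeA
  exact (contDiff_const.sub (contDiff_norm_sq ℝ)).mul (contDiff_brInv_comp.pow 5)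

/-- `y ↦ B(|y|²)` is smooth. [folklore] -/
theorem contDiff_modeB_comp {n : ℕ∞} : ContDiff ℝ n (fun y : ℝ³ => modeB (‖y‖ ^ 2)) := by
  unfold modeB
  exact contDiff_const.mul (contDiff_brInv_comp.pow 5)

/-- `y ↦ ϖ(|y|²)` is smooth. [folklore] -/
theorem contDiff_modeP_comp {n : ℕ∞} : ContDiff ℝ n (fun y : ℝ³ => modeP (‖y‖ ^ 2)) := by
  unfold modeP
  refine ContDiff.mul ?_ (contDiff_brInv_comp.pow 9)
  exact ((((contDiff_norm_sq ℝ).pow 3).neg.add (contDiff_const.mul ((contDiff_norm_sq ℝ).pow 2))).add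
    (contDiff_const.mul (contDiff_norm_sq ℝ))).sub contDiff_const

/-- `y ↦ ⟨m, y⟩` is smooth. [folklore] -/
theorem contDiff_inner_const (m : ℝ³) {n : ℕ∞} : ContDiff ℝ n (fun y : ℝ³ => ⟪m, y⟫) :=
  ContDiff.inner ℝ contDiff_const contDiff_id

/-- The scalar `φ(y) = B(|y|²)(m·y)`. -/
theorem contDiff_phi (m : ℝ³) {n : ℕ∞} :
    ContDiff ℝ n (fun y : ℝ³ => modeB (‖y‖ ^ 2) * ⟪m, y⟫) :=
  contDiff_modeB_comp.mul (contDiff_inner_const m)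

/-- `W` is smooth. [folklore] -/
theorem contDiff_neutralW (m : ℝ³) {n : ℕ∞} : ContDiff ℝ n (neutralW m) := by
  unfold neutralW
  exact (contDiff_modeA_comp.smul contDiff_const).add ((contDiff_phi m).smul contDiff_id)

/-- `Π` is smooth. [folklore] -/
theorem contDiff_neutralP (m : ℝ³) {n : ℕ∞} : ContDiff ℝ n (neutralP m) := by
  unfold neutralP
  exact contDiff_modeP_comp.mul (contDiff_inner_const m)

/-! ### §7.5 Pointwise calculus -/

section Calculus

variable (m : ℝ³)

/-- First derivative of a radial profile composed with `|y|²`. -/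
theorem hasFDerivAt_radial {g g₁ : ℝ → ℝ} (hg : ∀ σ : ℝ, -1 < σ → HasDerivAt g (g₁ σ) σ) (y : ℝ³) :
    HasFDerivAt (fun w : ℝ³ => g (‖w‖ ^ 2)) ((2 * g₁ (‖y‖ ^ 2)) • (innerSL ℝ y : ℝ³ →L[ℝ] ℝ)) y :=
  hasFDerivAt_comp_norm_sq (hg _ (neg_one_lt_norm_sq y))

/-- Laplacian of a radial profile composed with `|y|²` in dimension 3: `4σ g'' + 6 g'`. -/
theorem laplacian_radial {g g₁ g₂ : ℝ → ℝ} (hg : ∀ σ : ℝ, -1 < σ → HasDerivAt g (g₁ σ) σ)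
    (hg₁ : ∀ σ : ℝ, -1 < σ → HasDerivAt g₁ (g₂ σ) σ) (y : ℝ³) :
    (Δ (fun w : ℝ³ => g (‖w‖ ^ 2))) y = 4 * g₂ (‖y‖ ^ 2) * ‖y‖ ^ 2 + 6 * g₁ (‖y‖ ^ 2) := by
  have h := laplacian_comp_norm_sq (E := ℝ³) isOpen_Ioi (fun σ hσ => hg σ hσ) (neg_one_lt_norm_sq y)
    (hg₁ _ (neg_one_lt_norm_sq y))
  rw [h, finrank_euclideanSpace_fin]
  push_cast
  ring

/-- Derivative of `φ(y) = g(|y|²)(m·y)`. -/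
theorem hasFDerivAt_radial_mul_inner {g g₁ : ℝ → ℝ} (hg : ∀ σ : ℝ, -1 < σ → HasDerivAt g (g₁ σ) σ)
    (y : ℝ³) :
    HasFDerivAt (fun w : ℝ³ => g (‖w‖ ^ 2) * ⟪m, w⟫)
      (g (‖y‖ ^ 2) • (innerSL ℝ m : ℝ³ →L[ℝ] ℝ) +
        ⟪m, y⟫ • ((2 * g₁ (‖y‖ ^ 2)) • (innerSL ℝ y : ℝ³ →L[ℝ] ℝ))) y :=
  (hasFDerivAt_radial hg y).fun_mul (innerSL ℝ m).hasFDerivAt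

/-- Gradient of `φ(y) = g(|y|²)(m·y)`: `g m + 2 g' (m·y) y`. -/
theorem gradient_radial_mul_inner {g g₁ : ℝ → ℝ} (hg : ∀ σ : ℝ, -1 < σ → HasDerivAt g (g₁ σ) σ)
    (y : ℝ³) :
    gradient (fun w : ℝ³ => g (‖w‖ ^ 2) * ⟪m, w⟫) y =
      g (‖y‖ ^ 2) • m + (2 * g₁ (‖y‖ ^ 2) * ⟪m, y⟫) • y := by
  have hF := hasFDerivAt_radial_mul_inner m hg y
  have hv : g (‖y‖ ^ 2) • (innerSL ℝ m : ℝ³ →L[ℝ] ℝ) +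
        ⟪m, y⟫ • ((2 * g₁ (‖y‖ ^ 2)) • (innerSL ℝ y : ℝ³ →L[ℝ] ℝ)) =
      InnerProductSpace.toDual ℝ ℝ³ (g (‖y‖ ^ 2) • m + (2 * g₁ (‖y‖ ^ 2) * ⟪m, y⟫) • y) := by
    ext w
    simp only [add_apply, smul_apply,
      innerSL_apply_apply, smul_eq_mul, InnerProductSpace.toDual_apply_apply, inner_add_left, real_inner_smul_left]
    ring
  rw [hv] at hF
  exact (hasGradientAt_iff_hasFDerivAt.2 hF).gradient

/-- The Laplacian of a continuous linear map vanishes. -/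
theorem laplacian_clm {F : Type*} [NormedAddCommGroup F] [InnerProductSpace ℝ F] (l : ℝ³ →L[ℝ] F)
    (y : ℝ³) : (Δ (fun w : ℝ³ => l w)) y = 0 := by
  rw [laplacian_eq_sum_fderiv_fderiv (stdOrthonormalBasis ℝ ℝ³) (l.contDiff.of_le le_top) y]
  refine Finset.sum_eq_zero fun i _ => ?_
  have h1 : (fun w : ℝ³ => fderiv ℝ (fun w : ℝ³ => l w) w (stdOrthonormalBasis ℝ ℝ³ i)) =
      fun _ => l (stdOrthonormalBasis ℝ ℝ³ i) := by
    funext w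
    rw [show (fun w : ℝ³ => l w) = l from rfl, l.fderiv]
  rw [h1]
  simp

/-- Laplacian of `φ(y) = g(|y|²)(m·y)`: `(4σ g'' + 10 g')(m·y)`. -/
theorem laplacian_radial_mul_inner {g g₁ g₂ : ℝ → ℝ} (hg : ∀ σ : ℝ, -1 < σ → HasDerivAt g (g₁ σ) σ)
    (hg₁ : ∀ σ : ℝ, -1 < σ → HasDerivAt g₁ (g₂ σ) σ) (hgc : ContDiff ℝ 2 (fun w : ℝ³ => g (‖w‖ ^ 2)))
    (y : ℝ³) :
    (Δ (fun w : ℝ³ => g (‖w‖ ^ 2) * ⟪m, w⟫)) y =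
      (4 * g₂ (‖y‖ ^ 2) * ‖y‖ ^ 2 + 10 * g₁ (‖y‖ ^ 2)) * ⟪m, y⟫ := by
  set b := stdOrthonormalBasis ℝ ℝ³ with hb
  have hl : ContDiff ℝ 2 (fun w : ℝ³ => ⟪m, w⟫) := contDiff_inner_const m
  rw [laplacian_mul_eq b hgc hl y, laplacian_radial hg hg₁ y]
  have h0 : (Δ (fun w : ℝ³ => ⟪m, w⟫)) y = 0 := laplacian_clm (innerSL ℝ m) y
  rw [h0, mul_zero, zero_add]
  have h1 : ∀ i, fderiv ℝ (fun w : ℝ³ => g (‖w‖ ^ 2)) y (b i) = 2 * g₁ (‖y‖ ^ 2) * ⟪y, b i⟫ := fun i => by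
    rw [(hasFDerivAt_radial hg y).fderiv]; simp
  have h2 : ∀ i, fderiv ℝ (fun w : ℝ³ => ⟪m, w⟫) y (b i) = ⟪b i, m⟫ := fun i => by
    rw [show (fun w : ℝ³ => ⟪m, w⟫) = (innerSL ℝ m : ℝ³ →L[ℝ] ℝ) from rfl, (innerSL ℝ m).fderiv,
      innerSL_apply_apply, real_inner_comm]
  simp_rw [h1, h2]
  have h3 : ∑ i, 2 * g₁ (‖y‖ ^ 2) * ⟪y, b i⟫ * ⟪b i, m⟫ = 2 * g₁ (‖y‖ ^ 2) * ⟪y, m⟫ := by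
    rw [← b.sum_inner_mul_inner y m, Finset.mul_sum]
    exact Finset.sum_congr rfl fun i _ => by ring
  rw [h3, real_inner_comm m y]
  ring

end Calculus

end Summit.NavierStokesRegularity.NavierStokesRegularity.Theorems.ScarRigidity.Negative

end
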